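import Summits.KontsevichZagierPeriods.KontsevichZagierPeriods.Theorems.UnfoldedStokesStokesGenerationStubSectorDecomposition
import Summits.KontsevichZagierPeriods.KontsevichZagierPeriods.Theorems.UnfoldedStokesStokesGenerationFibrewiseClosureCongr
import Literature.NumberTheory.Transcendental.SemialgebraicMapsProofs

/-!
# `StokesGeneration` (stmt-KontsevichZagierPeriods-3586), line `fibrewise_stokes` — rung 27 corollary: the shuffle product of
# two one-dimensional integrals is in S2's economy

Crux `Summit.KontsevichZagierPeriods.KontsevichZagierPeriods.Theses.UnfoldedStokes.StokesGeneration`; residual stub S2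
(`FibStokesDecomposable`, `Theorems/UnfoldedStokesDefs.lean`). Kuhn's subdivision of the square along its diagonal,
`f(s,t) ≡ s·f(s,st) + t·f(ts,t)` modulo Dec, is the case `N+1 = 2` of the sector decomposition by the largest coordinate
(`stub_sectorDecomposition`, rung 27: the radial scaling homotopy towards the apex). For a product `f = k₁ ⊗ k₂` it says that the
cube integrand of `(∫₀¹k₁)(∫₀¹k₂)` is congruent to the sum of the two ITERATED integrands — the shuffle relation of depth-two
iterated integrals (e.g. `log(1−a₁)log(1−a₂)` against `Li_{1,1}`-type integrands for `kᵢ = aᵢ/(1−aᵢs)`, `|aᵢ| < 1`), the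
geometric half of the double-shuffle structure, now inside S2's economy for all semialgebraic `C¹` one-forms on `[0,1]`.

References: M. Kontsevich, D. Zagier, *Periods* (2001), §1.2; A. B. Goncharov, *Multiple polylogarithms and mixed Tate motives*
(2001), §2 (shuffle product of iterated integrals).
-/

noncomputable section

-- `Summit.KontsevichZagierPeriods.KontsevichZagierPeriods.…` is the tree's mandated layout (single-conjunct summit).
set_option linter.dupNamespace false

namespace Summit.KontsevichZagierPeriods.KontsevichZagierPeriods.Cruxes.StokesGeneration.FibrewiseStokes

open MeasureTheory Set
open Literature.NumberTheory.Transcendental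
open Literature.NumberTheory.Transcendental.KZ
open Literature.ModelTheory.ExponentialFields (IsSemialgebraic)

/-- **The shuffle product of two one-dimensional integrals is in S2's economy (rung 27 at `N+1 = 2`, lead c6).** For `k₁, k₂`
`ℚ`-semialgebraic and `C¹` on an open interval `I ⊇ [0,1]`, the cube integrand `k₁(s)k₂(t)` of the product `(∫₀¹k₁)(∫₀¹k₂)` is
congruent modulo Dec to the sum of the two ITERATED integrands `s·k₁(s)k₂(st)` (`∫∫_{t<s}`) and `t·k₁(ts)k₂(t)` (`∫∫_{s<t}`):
Kuhn's subdivision of the square, i.e. `stub_sectorDecomposition` for `f(s,t) = k₁(s)k₂(t)`. For `kᵢ(s) = aᵢ/(1 − aᵢs)`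
(`|aᵢ| < 1`) this is the shuffle relation `log(1−a₁)log(1−a₂) = Li_{1,1}(a₂… )+ Li_{1,1}(a₁…)` of depth-two iterated
integrals; in general it is the geometric half of the double-shuffle structure. [cite: KontsevichZagier2001, §1.2 rules (1), (2)] -/
theorem fibStokesDecomposable_shuffleTwo (I : Set ℝ) (hI : IsOpen I) (hIcc : Set.Icc (0:ℝ) 1 ⊆ I) (k₁ k₂ : ℝ → ℝ)
    (hk₁ : IsSemialgebraicFunOn ℚ {z : Fin 1 → ℝ | z 0 ∈ I} (fun z => k₁ (z 0)))
    (hk₂ : IsSemialgebraicFunOn ℚ {z : Fin 1 → ℝ | z 0 ∈ I} (fun z => k₂ (z 0)))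
    (hk₁d : ContDiffOn ℝ 1 k₁ I) (hk₂d : ContDiffOn ℝ 1 k₂ I) :
    FibStokesDecomposable 2 (fun z => k₁ (z 0) * k₂ (z 1) -
      (z 0 * (k₁ (z 0) * k₂ (z 0 * z 1)) + z 1 * (k₁ (z 1 * z 0) * k₂ (z 1)))) := by
  -- the open set `U = I × I ⊆ ℝ²`
  obtain ⟨U, hU⟩ : ∃ U : Set (Fin 2 → ℝ), U = {x | x 0 ∈ I ∧ x 1 ∈ I} := ⟨_, rfl⟩
  have hUo : IsOpen U := by
    rw [hU]
    exact (hI.preimage (continuous_apply 0)).inter (hI.preimage (continuous_apply 1))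
  have hsI : IsSemialgebraic ℚ {z : Fin 1 → ℝ | z 0 ∈ I} := hk₁.isSemialgebraic_holds
  have hUsa : IsSemialgebraic ℚ U := by
    have h0 := (hsI.preimage_comp (fun _ : Fin 1 => (0 : Fin 2)))
    have h1 := (hsI.preimage_comp (fun _ : Fin 1 => (1 : Fin 2)))
    rw [hU]
    convert h0.inter h1 using 1
    ext x
    simp only [Set.mem_setOf_eq, Set.mem_inter_iff, Set.mem_preimage, Function.comp]
  have hCU : Set.pi Set.univ (fun _ : Fin 2 => Set.Icc (0:ℝ) 1) ⊆ U := by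
    intro x hx
    have hm : ∀ i, x i ∈ Set.Icc (0:ℝ) 1 := fun i => (Set.mem_univ_pi.mp hx) i
    rw [hU]; exact ⟨hIcc (hm 0), hIcc (hm 1)⟩
  -- `f(x) = k₁(x 0) k₂(x 1)` is semialgebraic and `C¹` on `U`
  have hf : IsSemialgebraicFunOn ℚ U (fun x => k₁ (x 0) * k₂ (x 1)) := by
    have r0 := (isSemialgebraicFunOn_comp_coord hk₁ (fun _ : Fin 1 => (0 : Fin 2))).mono
      (fun x hx => by rw [hU] at hx; exact hx.1) hUsa
    have r1 := (isSemialgebraicFunOn_comp_coord hk₂ (fun _ : Fin 1 => (1 : Fin 2))).mono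
      (fun x hx => by rw [hU] at hx; exact hx.2) hUsa
    exact r0.fun_mul r1
  have hfd : ContDiffOn ℝ 1 (fun x : Fin 2 → ℝ => k₁ (x 0) * k₂ (x 1)) U := by
    refine ContDiffOn.mul (hk₁d.comp (contDiff_apply ℝ ℝ (0 : Fin 2)).contDiffOn fun x hx => ?_)
      (hk₂d.comp (contDiff_apply ℝ ℝ (1 : Fin 2)).contDiffOn fun x hx => ?_)
    · rw [hU] at hx; exact hx.1
    · rw [hU] at hx; exact hx.2
  have key : FibStokesDecomposable 2 (fun x => k₁ (x 0) * k₂ (x 1) -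
      ∑ j : Fin 2, x j ^ 1 * (k₁ (Function.update (x j • x) j (x j) 0) * k₂ (Function.update (x j • x) j (x j) 1))) :=
    stub_sectorDecomposition (N := 1) U hUo hCU (fun x => k₁ (x 0) * k₂ (x 1)) hf hfd
  refine fibStokesDecomposable_congr_off_null 2 _ _ ∅
    Literature.ModelTheory.ExponentialFields.isSemialgebraic_empty measure_empty (fun z _ _ => ?_) key
  simp only [Fin.sum_univ_two, pow_one, Function.update_self, Function.update_of_ne (show (1 : Fin 2) ≠ 0 by decide),
    Function.update_of_ne (show (0 : Fin 2) ≠ 1 by decide), Pi.smul_apply, smul_eq_mul]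

end Summit.KontsevichZagierPeriods.KontsevichZagierPeriods.Cruxes.StokesGeneration.FibrewiseStokes

end
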